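import Summits.Ventures.LatticeQCDFlow.Scaling.OfferCeilingLadderAndMaps

/-!
HONEST FRAMING: exact (Metropolis-corrected) sampling algorithms for lattice gauge theory; figures
of merit are autocorrelation/cost numbers at stated couplings and volumes; no continuum-physics
claim.

# TwoLevelFlowExchange — THE SIMPLEST MAP-ASSISTED EXCHANGE SAMPLER: ONE TUNNELLING ENSEMBLE `μ_0` (UPDATE `M_0`,
# POINCARÉ CONSTANT `γ₀`), ONE TARGET `μ_1`, ONE BIJECTION `φ`, A METROPOLIS SWAP THROUGH `φ` W.P. `t`, ELSE AN UPDATE OF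
# THE TUNNELLING ENSEMBLE: UNDER TRANSPORTED ONE-SIDED DOMINATION `p·μ_1(φu) ≤ μ_0(u)`,
# `p·min{t, γ₀(1−t)}/14 ≤ Gap ≤ 2t·μ_0(u)/μ_1(φu)` (ANY `u` WITH `μ_1(φu) ≤ ½`); AT `t = γ₀/(1+γ₀)`: `Gap ≥ pγ₀/28`
# (lean-2 GEN-22, ours)

Venture-side (OURS).  Cell `lqcd-flow` (pub-lqcd), unit `pub-lqcd-lean-2-g22`, 2026-08-26.  Chapter J, file 15: the
`K = 1` case of `Scaling/OneSidedHubFloor` (J8) and `Scaling/ExchangeOfferCeiling` (J10), written out because it is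
the exchange move the flow literature actually runs — a trained map `φ` between an ensemble that tunnels (coarse,
hot, open boundary) and the target, a Metropolis-corrected swap through `φ`, and updates spent on the tunnelling
ensemble only (the target ensemble is refreshed by the swaps alone).  State `x : Fin 2 → S` (`x_0` tunnelling, `x_1`
target), law `μ_0 ⊗ μ_1`, sampler `P^φ = t·ptGraphSwap μ e_⋆ φ + (1−t)·prodKernel 𝟙_{0} M`.  What enters: the swap
fraction `t`, the tunnelling ensemble's Poincaré constant `γ₀`, and the ONE-SIDED transported domination ratio `p`
(`p·μ_1(φu) ≤ μ_0(u)`: the map never lands hot mass more than `1/p` below the target's weight; for a sector-reweighted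
transport `μ_1∘φ = (r∘mode)·μ_0` this is `p·r ≤ 1`, the target may suppress any sector arbitrarily).

## What is proved

* **`twoLevelFlow_spectralGap_ge`** — `Gap(P^φ) ≥ p·min{t, γ₀(1−t)}/14`.
* **`twoLevelFlow_spectralGap_le`** — `Gap(P^φ) ≤ 2t·μ_0(u)/μ_1(φu)` for every `u` with `μ_1(φu) ≤ ½` (no domination
  hypothesis): the transported ratio at a single configuration caps the rate.
* **`twoLevelFlow_spectralGap_ge_tuned`** — at `t = γ₀/(1+γ₀)` (`γ₀ ≤ 1`): `Gap ≥ p·γ₀/28`;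
  **`twoLevelFlow_tauInt_le`** — `τ_int(g) ≤ 14/(p·min{t,γ₀(1−t)}) − ½` for every observable (`M_0` irreducible).

NOT CLAIMED: continuous configuration spaces (Jacobians enter the swap test); stochastic or non-bijective maps;
anything measured.  Literature grade (cell rule): ELEMENTARY COROLLARIES (`K = 1`); nothing cited as a fact; no new
bib keys.
-/

noncomputable section

open Finset Function
open Literature.Probability.MarkovChains

namespace Summit.Ventures.LatticeQCDFlow.Scaling

section TwoLevel

variable {S : Type*} [Fintype S] [DecidableEq S] {μ : Fin 2 → S → ℝ} {M : Fin 2 → S → S → ℝ} {t : ℝ}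
  (φ : Equiv.Perm S)

/-- **THE TWO-LEVEL MAP-ASSISTED EXCHANGE SAMPLER RELAXES AT LEAST AT `p·min{t, γ₀(1−t)}/14`:** transported
one-sided domination `p·μ_1(φu) ≤ μ_0(u)` (`0 < p ≤ 1`), tunnelling update `M_0` with Poincaré constant `γ₀`, target
update `M_1` arbitrary `μ_1`-reversible (never applied), `0 < t < 1`, `|S| ≥ 2`. [ours] -/
theorem twoLevelFlow_spectralGap_ge [Nontrivial S] (hμ : ∀ k x, 0 < μ k x) (hμ1 : ∀ k, ∑ u, μ k u = 1)
    (hM : ∀ k, IsRowStochastic (M k)) (hMrev : ∀ k, DetailedBalance (μ k) (M k)) (ht0 : 0 < t) (ht1 : t < 1)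
    {p γ₀ : ℝ} (hp : 0 < p) (hp1 : p ≤ 1) (hγ₀ : 0 < γ₀) (hdom : ∀ u : S, p * μ 1 (φ u) ≤ μ 0 u)
    (hgap0 : ∀ h : S → ℝ, γ₀ * lawVariance (μ 0) h ≤ dirichletForm (μ 0) (M 0) h) :
    p * min t (γ₀ * (1 - t)) / 14
      ≤ spectralGap (tensorFun μ) (fun x y : Fin 2 → S =>
          t * ptGraphSwap μ (fun k : Fin 1 => ((0 : Fin 2), k.succ)) (fun _ : Fin 1 => φ) x y
            + (1 - t) * prodKernel (fun k : Fin 2 => if k = 0 then (1 : ℝ) else 0) M x y) := by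
  have hw0 : ∀ k : Fin 2, 0 ≤ (if k = 0 then (1 : ℝ) else 0) := fun k => by positivity
  have hdom' : ∀ (k : Fin 1) (u : S), p * μ k.succ ((fun _ : Fin 1 => φ) k u) ≤ μ 0 u := fun k u => by
    have hk : k = 0 := Subsingleton.elim _ _
    subst hk; exact hdom u
  have h := oneSidedFlowStar_spectralGap_ge (K := 1) (M := M) (w := fun k : Fin 2 => if k = 0 then (1 : ℝ) else 0)
    (fun _ : Fin 1 => φ) le_rfl hμ hμ1 hM hMrev hw0 hotOnlyWeight_sum (by simp) ht0 ht1 hp hp1 hγ₀ hdom' hgap0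
  simp only [if_true, mul_one, Nat.cast_one, mul_one] at h
  refine le_trans ?_ h
  rw [show p * min t (γ₀ * (1 - t)) / 14 = p * (min t (γ₀ * (1 - t)) / 14) by ring]
  refine mul_le_mul_of_nonneg_left (le_min ?_ ?_) hp.le
  · calc min t (γ₀ * (1 - t)) / 14 ≤ t / 14 := div_le_div_of_nonneg_right (min_le_left _ _) (by norm_num)
      _ ≤ t / 6 := div_le_div_of_nonneg_left ht0.le (by norm_num) (by norm_num)
  · exact div_le_div_of_nonneg_right (min_le_right _ _) (by norm_num)

/-- **… AND AT MOST AT `2t·μ_0(u)/μ_1(φu)`** for every `u` with `μ_1(φu) ≤ ½` — the transported weight ratio at one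
configuration caps the rate (`0 ≤ t ≤ 1`; no domination hypothesis). [ours] -/
theorem twoLevelFlow_spectralGap_le [Nontrivial S] (hμ : ∀ k x, 0 < μ k x) (hμ1 : ∀ k, ∑ u, μ k u = 1)
    (hM : ∀ k, IsRowStochastic (M k)) (hMrev : ∀ k, DetailedBalance (μ k) (M k)) (ht0 : 0 ≤ t) (ht1 : t ≤ 1)
    {u : S} (hu : μ 1 (φ u) ≤ 1 / 2) :
    spectralGap (tensorFun μ) (fun x y : Fin 2 → S =>
        t * ptGraphSwap μ (fun k : Fin 1 => ((0 : Fin 2), k.succ)) (fun _ : Fin 1 => φ) x y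
          + (1 - t) * prodKernel (fun k : Fin 2 => if k = 0 then (1 : ℝ) else 0) M x y)
      ≤ 2 * t * (μ 0 u / μ 1 (φ u)) := by
  have hw0 : ∀ k : Fin 2, 0 ≤ (if k = 0 then (1 : ℝ) else 0) := fun k => by positivity
  have h := flowStar_spectralGap_le_config (K := 1) (M := M) (w := fun k : Fin 2 => if k = 0 then (1 : ℝ) else 0)
    (t := t) (fun _ : Fin 1 => φ) hμ hμ1 hM hMrev hw0 hotOnlyWeight_sum ht0 ht1 (0 : Fin 1) u
  have e1 : ((0 : Fin 1).succ : Fin 2) = 1 := rfl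
  simp only [e1] at h
  norm_num at h
  refine h.trans ?_
  have hμ1u : 0 < μ 1 (φ u) := hμ _ _
  have h1 : 1 / 2 ≤ 1 - μ 1 (φ u) := by linarith
  rw [div_le_iff₀ (mul_pos hμ1u (by linarith))]
  have e : 2 * t * (μ 0 u / μ 1 (φ u)) * (μ 1 (φ u) * (1 - μ 1 (φ u))) = t * μ 0 u * (2 * (1 - μ 1 (φ u))) := by
    field_simp
  rw [e]
  have : (1 : ℝ) ≤ 2 * (1 - μ 1 (φ u)) := by linarith
  calc t * μ 0 u = t * μ 0 u * 1 := (mul_one _).symm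
    _ ≤ t * μ 0 u * (2 * (1 - μ 1 (φ u))) := mul_le_mul_of_nonneg_left this (mul_nonneg ht0 (hμ 0 u).le)

/-- **TUNED SWAP FRACTION:** at `t = γ₀/(1+γ₀)` (`0 < γ₀ ≤ 1`) both terms of the floor coincide and
`Gap(P^φ) ≥ p·γ₀/28`. [ours] -/
theorem twoLevelFlow_spectralGap_ge_tuned [Nontrivial S] (hμ : ∀ k x, 0 < μ k x) (hμ1 : ∀ k, ∑ u, μ k u = 1)
    (hM : ∀ k, IsRowStochastic (M k)) (hMrev : ∀ k, DetailedBalance (μ k) (M k)) {p γ₀ : ℝ} (hp : 0 < p) (hp1 : p ≤ 1)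
    (hγ₀ : 0 < γ₀) (hγ₁ : γ₀ ≤ 1) (hdom : ∀ u : S, p * μ 1 (φ u) ≤ μ 0 u)
    (hgap0 : ∀ h : S → ℝ, γ₀ * lawVariance (μ 0) h ≤ dirichletForm (μ 0) (M 0) h) :
    p * γ₀ / 28
      ≤ spectralGap (tensorFun μ) (fun x y : Fin 2 → S =>
          γ₀ / (1 + γ₀) * ptGraphSwap μ (fun k : Fin 1 => ((0 : Fin 2), k.succ)) (fun _ : Fin 1 => φ) x y
            + (1 - γ₀ / (1 + γ₀)) * prodKernel (fun k : Fin 2 => if k = 0 then (1 : ℝ) else 0) M x y) := by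
  have ht0 : 0 < γ₀ / (1 + γ₀) := by positivity
  have ht1 : γ₀ / (1 + γ₀) < 1 := by rw [div_lt_one (by linarith)]; linarith
  have h := twoLevelFlow_spectralGap_ge (M := M) φ hμ hμ1 hM hMrev ht0 ht1 hp hp1 hγ₀ hdom hgap0
  refine le_trans ?_ h
  have hmin : min (γ₀ / (1 + γ₀)) (γ₀ * (1 - γ₀ / (1 + γ₀))) = γ₀ / (1 + γ₀) := by
    rw [min_eq_left]
    have e : γ₀ * (1 - γ₀ / (1 + γ₀)) = γ₀ / (1 + γ₀) := by field_simp; ring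
    rw [e]
  rw [hmin]
  -- `pγ₀/28 ≤ p·(γ₀/(1+γ₀))/14` since `1 + γ₀ ≤ 2`
  rw [div_le_div_iff₀ (by norm_num) (by norm_num)]
  have h2 : γ₀ * 14 ≤ γ₀ / (1 + γ₀) * 28 := by
    rw [div_mul_eq_mul_div, le_div_iff₀ (by linarith)]
    nlinarith
  nlinarith [mul_le_mul_of_nonneg_left h2 hp.le]

/-- **EVERY OBSERVABLE:** `τ_int(g) ≤ 14/(p·min{t, γ₀(1−t)}) − ½` (tunnelling update irreducible). [ours] -/
theorem twoLevelFlow_tauInt_le [Nontrivial S] (hμ : ∀ k x, 0 < μ k x) (hμ1 : ∀ k, ∑ u, μ k u = 1)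
    (hM : ∀ k, IsRowStochastic (M k)) (hMrev : ∀ k, DetailedBalance (μ k) (M k)) (hM0 : IsIrreducible (M 0))
    (ht0 : 0 < t) (ht1 : t < 1) {p γ₀ : ℝ} (hp : 0 < p) (hp1 : p ≤ 1) (hγ₀ : 0 < γ₀)
    (hdom : ∀ u : S, p * μ 1 (φ u) ≤ μ 0 u)
    (hgap0 : ∀ h : S → ℝ, γ₀ * lawVariance (μ 0) h ≤ dirichletForm (μ 0) (M 0) h)
    {g : (Fin 2 → S) → ℝ} (hg : 0 < lawVariance (tensorFun μ) g) :
    asympVar g (tensorFun μ) (fun x y : Fin 2 → S =>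
        t * ptGraphSwap μ (fun k : Fin 1 => ((0 : Fin 2), k.succ)) (fun _ : Fin 1 => φ) x y
          + (1 - t) * prodKernel (fun k : Fin 2 => if k = 0 then (1 : ℝ) else 0) M x y)
      / (2 * lawVariance (tensorFun μ) g) ≤ 14 / (p * min t (γ₀ * (1 - t))) - 1 / 2 := by
  have hw0 : ∀ k : Fin 2, 0 ≤ (if k = 0 then (1 : ℝ) else 0) := fun k => by positivity
  have hc0 : 0 < p * min t (γ₀ * (1 - t)) / 14 :=
    div_pos (mul_pos hp (lt_min ht0 (mul_pos hγ₀ (by linarith)))) (by norm_num)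
  have h := tauInt_le_of_gapFloor (tensorFun_pos hμ) (sum_tensorFun_eq_one μ hμ1)
    (weightedScheme_isRowStochastic (ptGraphSwap_isRowStochastic hμ) hM hw0 hotOnlyWeight_sum ht0.le ht1.le)
    (weightedScheme_detailedBalance (ptGraphSwap_detailedBalance hμ) hMrev t)
    (flowStar_isIrreducible_of_hot (fun _ : Fin 1 => φ) hμ hM hM0 hw0 hotOnlyWeight_sum (by simp) ht0 ht1) hc0
    (twoLevelFlow_spectralGap_ge φ hμ hμ1 hM hMrev ht0 ht1 hp hp1 hγ₀ hdom hgap0) hg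
  rw [one_div_div] at h
  exact h

end TwoLevel

end Summit.Ventures.LatticeQCDFlow.Scaling

end
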